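import Summits.QuantumAdvantage.AdviceFreeQNC0.M19IntervalLoss
import HarnessLib

/-!
# M19 part 5: THEOREM A `affineTestsLoss` (Boolean functions of `K` affine forms mod `p`)

PROVENANCE / PORT (ask P2-19a): authored by the planner seat qa-qnc0-p2 g19 (`HOME/qa-qnc0-p2/line19/M19Proofs.lean`, 1542 lines,
farm rc 0 / 0 sorry / 0 warnings), ported by qn-prover-3 g12 as six files `M19Linearisation` → `M19SegmentCounter` →
`M19FormExpansion` → `M19IntervalLoss` → `M19AffineTests` → `M19StepForms`; everything is placed in the namespace
`Summit.QuantumAdvantage.AdviceFreeQNC0.M19` (so `M19.winCount` / `M19.lossCount` do not shadow the cell's `AffBells22.winCount`),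
28 one-line docstrings were added, nothing else changed.  Separation NOT moved.
-/

/-! ## Theorem A — functions of `K` arbitrary affine forms mod `p` per cut: greedy posts, polynomial loss
`#LOSE ≥ 2^{n − k}`, `k = 2p·⌈log₂(2(n+1)p^K)⌉` (settles (E-lin)/(E⁺-lin) of ROUND-17 §4 up to this `k`). -/

section AffineA

namespace Summit.QuantumAdvantage.AdviceFreeQNC0.M19

open Finset

variable {F : Type} [Field F]

omit [Field F] in
/-- pigeonhole: some fibre carries at least a `1/#A` fraction. -/
theorem exists_popular_letter [DecidableEq F] {ι : Type} (S : Finset ι) (φ : ι → F) (A : Finset F) (hA : A.Nonempty)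
    (hφ : ∀ t ∈ S, φ t ∈ A) : ∃ a ∈ A, S.card ≤ A.card * (S.filter fun t => φ t = a).card := by
  classical
  have hsum : S.card = ∑ a ∈ A, (S.filter fun t => φ t = a).card :=
    Finset.card_eq_sum_card_fiberwise (fun t ht => hφ t ht)
  have hle : ∑ _a ∈ A, S.card ≤ ∑ a ∈ A, A.card * (S.filter fun t => φ t = a).card := by
    rw [Finset.sum_const, smul_eq_mul, ← Finset.mul_sum, ← hsum]
  exact Finset.exists_le_of_sum_le hA hle

omit [Field F] in
/-- **Greedy posts.** Letters from an alphabet `A` with `#A ≤ D`: posting, coordinate by coordinate, the most popular letter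
among the surviving terms gives `D^k · #survivors ≤ (D−1)^k · #T` after the first `k` coordinates. -/
theorem greedy_posts [DecidableEq F] {ι : Type} (T : Finset ι) {n : ℕ} (ρ : ι → Fin n → F) (A : Finset F) (hA : A.Nonempty)
    (D : ℕ) (hD : A.card ≤ D) (hρ : ∀ t ∈ T, ∀ i, ρ t i ∈ A) :
    ∀ k, k ≤ n → ∃ α : Fin n → F, (∀ i, α i ∈ A) ∧
      D ^ k * (T.filter fun t => ∀ i : Fin n, i.val < k → ρ t i ≠ α i).card ≤ (D - 1) ^ k * T.card := by
  classical
  intro k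
  induction k with
  | zero =>
    intro _
    obtain ⟨a0, ha0⟩ := hA
    refine ⟨fun _ => a0, fun _ => ha0, ?_⟩
    simp only [pow_zero, one_mul]
    exact Finset.card_filter_le _ _
  | succ k ih =>
    intro hk
    obtain ⟨α, hαA, hbound⟩ := ih (Nat.le_of_succ_le hk)
    set S := T.filter fun t => ∀ i : Fin n, i.val < k → ρ t i ≠ α i with hS
    let kk : Fin n := ⟨k, hk⟩
    obtain ⟨a, haA, hpop⟩ := exists_popular_letter S (fun t => ρ t kk) A hA
      (fun t ht => hρ t (Finset.mem_filter.mp ht).1 kk)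
    refine ⟨Function.update α kk a, ?_, ?_⟩
    · intro i
      by_cases hi : i = kk
      · rw [hi, Function.update_self]; exact haA
      · rw [Function.update_of_ne hi]; exact hαA i
    · have hsurv : (T.filter fun t => ∀ i : Fin n, i.val < k + 1 → ρ t i ≠ Function.update α kk a i)
          = S.filter fun t => ¬ ρ t kk = a := by
        rw [hS, Finset.filter_filter]
        refine Finset.filter_congr (fun t _ => ?_)
        constructor
        · intro h
          refine ⟨fun i hi => ?_, ?_⟩
          · have hne : i ≠ kk := by
              intro h'
              rw [h'] at hi
              exact lt_irrefl k hi
            have := h i (by omega)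
            rwa [Function.update_of_ne hne] at this
          · have := h kk (show k < k + 1 by omega)
            rwa [Function.update_self] at this
        · rintro ⟨h1, h2⟩ i hi
          by_cases hne : i = kk
          · rw [hne, Function.update_self]; exact h2
          · rw [Function.update_of_ne hne]
            have : i.val ≠ k := fun h' => hne (Fin.ext h')
            exact h1 i (by omega)
      rw [hsurv]
      have hsplit := Finset.card_filter_add_card_filter_not (s := S) (p := fun t => ρ t kk = a)
      have h1 : S.card ≤ D * (S.filter fun t => ρ t kk = a).card := hpop.trans (Nat.mul_le_mul_right _ hD)
      have hmul : D * (S.filter fun t => ρ t kk = a).card + D * (S.filter fun t => ¬ ρ t kk = a).card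
          = D * S.card := by rw [← Nat.mul_add, hsplit]
      have hD1 : (D - 1) * S.card = D * S.card - S.card := Nat.sub_one_mul D S.card
      have hstep : D * (S.filter fun t => ¬ ρ t kk = a).card ≤ (D - 1) * S.card := by omega
      calc D ^ (k + 1) * (S.filter fun t => ¬ ρ t kk = a).card
          = D ^ k * (D * (S.filter fun t => ¬ ρ t kk = a).card) := by ring
        _ ≤ D ^ k * ((D - 1) * S.card) := Nat.mul_le_mul_left _ hstep
        _ = (D - 1) * (D ^ k * S.card) := by ring
        _ ≤ (D - 1) * ((D - 1) ^ k * T.card) := Nat.mul_le_mul_left _ hbound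
        _ = (D - 1) ^ (k + 1) * T.card := by ring

/-- strict Bernoulli in ℕ: `2·(D−1)^D < D^D` for `D ≥ 1` (so `(1 − 1/D)^D < 1/2`). -/
theorem two_mul_pow_lt_pow (D : ℕ) (hD : 1 ≤ D) : 2 * (D - 1) ^ D < D ^ D := by
  rcases Nat.lt_or_ge D 2 with hlt | h2
  · have : D = 1 := by omega
    subst this
    norm_num
  · have hB := (Commute.all (D - 1 : ℕ) 1).pow_add_mul_le_add_pow_of_sq_nonneg (Nat.zero_le _) (Nat.zero_le _)
      (Nat.zero_le _) (Nat.zero_le _) D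
    simp only [Nat.cast_id, mul_one, Nat.sub_add_cancel hD] at hB
    -- hB : (D-1)^D + D * (D-1)^(D-1) ≤ D^D
    have hpos : 0 < (D - 1) ^ (D - 1) := Nat.pow_pos (by omega)
    have h3 : (D - 1) ^ D = (D - 1) ^ (D - 1) * (D - 1) := by
      conv_lhs => rw [show D = (D - 1) + 1 from (Nat.sub_add_cancel hD).symm, pow_succ, Nat.add_sub_cancel]
    have h4 : (D - 1) ^ (D - 1) * (D - 1) < (D - 1) ^ (D - 1) * D :=
      (Nat.mul_lt_mul_left hpos).mpr (by omega)
    have h5 : D * (D - 1) ^ (D - 1) = (D - 1) ^ (D - 1) * D := Nat.mul_comm _ _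
    omega

variable {p : ℕ} [NeZero p] (ψ : AddChar (ZMod p) F) (η : F)

/-- the letter alphabet `μ_p·{η, η²}` as a finset. -/
noncomputable def letterAlphabet (p : ℕ) [NeZero p] (ψ : AddChar (ZMod p) F) (η : F) : Finset F := by
  classical
  exact ((univ : Finset (ZMod p)).image fun z => ψ z * η ^ 1) ∪ ((univ : Finset (ZMod p)).image fun z => ψ z * η ^ 2)

/-- The letter alphabet has at most `2p` letters. -/
theorem letterAlphabet_card : (letterAlphabet p ψ η).card ≤ 2 * p := by
  classical
  unfold letterAlphabet
  refine (Finset.card_union_le _ _).trans ?_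
  have h1 : ((univ : Finset (ZMod p)).image fun z => ψ z * η ^ 1).card ≤ p :=
    Finset.card_image_le.trans (by rw [Finset.card_univ, ZMod.card])
  have h2 : ((univ : Finset (ZMod p)).image fun z => ψ z * η ^ 2).card ≤ p :=
    Finset.card_image_le.trans (by rw [Finset.card_univ, ZMod.card])
  omega

/-- The letter alphabet is nonempty. -/
theorem letterAlphabet_nonempty : (letterAlphabet p ψ η).Nonempty := by
  classical
  unfold letterAlphabet
  exact ⟨ψ 0 * η ^ 1, Finset.mem_union_left _ (Finset.mem_image.mpr ⟨0, Finset.mem_univ _, rfl⟩)⟩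

/-- `ψ(z)·η^e ∈ letterAlphabet` for `e ∈ {1, 2}`. -/
theorem mem_letterAlphabet (z : ZMod p) (e : ℕ) (he : e = 1 ∨ e = 2) : ψ z * η ^ e ∈ letterAlphabet p ψ η := by
  classical
  unfold letterAlphabet
  rcases he with rfl | rfl
  · exact Finset.mem_union_left _ (Finset.mem_image.mpr ⟨z, Finset.mem_univ _, rfl⟩)
  · exact Finset.mem_union_right _ (Finset.mem_image.mpr ⟨z, Finset.mem_univ _, rfl⟩)

omit [NeZero p] in
/-- Letters are `≠ 1`. -/
theorem ne_one_of_mem_letterAlphabet [NeZero p] (hη : IsPrimitiveRoot η 3) (h3 : ¬ 3 ∣ p)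
    (hψp : ∀ z : ZMod p, (ψ z) ^ p = 1) (x : F) (hx : x ∈ letterAlphabet p ψ η) : x ≠ 1 := by
  classical
  unfold letterAlphabet at hx
  rcases Finset.mem_union.mp hx with h | h
  · obtain ⟨z, _, rfl⟩ := Finset.mem_image.mp h
    exact psi_mul_eta_pow_ne_one ψ η hη h3 hψp z 1 (Or.inl rfl)
  · obtain ⟨z, _, rfl⟩ := Finset.mem_image.mp h
    exact psi_mul_eta_pow_ne_one ψ η hη h3 hψp z 2 (Or.inr rfl)

omit [NeZero p] in
/-- The letters of the form expansion lie in the letter alphabet. -/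
theorem formρ_mem_letterAlphabet [NeZero p] (hη3 : η ^ 3 = 1) {n K : ℕ} (L : Fin (n + 1) → Fin K → Fin n → ZMod p)
    (g : Fin (n + 1)) (cv : Fin K → ZMod p) (b : Fin 2) (i : Fin n) :
    formρ ψ η L g cv b i ∈ letterAlphabet p ψ η := by
  obtain ⟨e, he, hlab⟩ := label_letter η hη3 b (i.val < g.val)
  unfold formρ
  rw [hlab]
  exact mem_letterAlphabet ψ η _ e he

/-- the form expansion with the residue index summed into the coefficient: `2(n+1)p^K` terms. -/
theorem form_expansion' [CharP F 2] (hη3 : η ^ 3 = 1) (hη1 : η ≠ 1) (hp : Odd p) {ξ : F} (hξ : IsPrimitiveRoot ξ p)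
    (hψ : ∀ z : ZMod p, ψ z = ξ ^ z.val)
    {n K : ℕ} (c : ℕ) (y : Fin (n + 1) → (Fin n → Bool) → Bool)
    (L : Fin (n + 1) → Fin K → Fin n → ZMod p) (β : Fin (n + 1) → Fin K → ZMod p)
    (f : Fin (n + 1) → (Fin K → ZMod p) → Bool)
    (hf : ∀ g u, y g u = f g (fun j => β g j + ∑ i, (if u i = true then L g j i else 0)))
    (u : Fin n → Bool) :
    (if ringWinU c y u = true then (1 : F) else 0)
      = ∑ t : Fin (n + 1) × (Fin K → ZMod p) × Fin 2,
          (∑ r : Fin K → ZMod p, formC ψ η c f β t.1 r t.2.1 t.2.2)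
            * ∏ i : Fin n, (if u i = true then formρ ψ η L t.1 t.2.1 t.2.2 i else 1) := by
  rw [form_expansion ψ η hη3 hη1 hp hξ hψ c y L β f hf u]
  rw [Fintype.sum_prod_type]
  conv_rhs => rw [Fintype.sum_prod_type]
  refine Finset.sum_congr rfl (fun g _ => ?_)
  rw [Fintype.sum_prod_type, Finset.sum_comm]
  refine Finset.sum_congr rfl (fun x _ => ?_)
  rw [Finset.sum_mul]

/-- Theorem A class (Sketch19 `IsAffineTestFn`): a Boolean function of `K` affine forms mod `p` of the input bits
(arbitrary dense coefficient vectors; `K = 1` = the VPE-lin counters `[L(u) ≡ a]` closed under arbitrary accepting sets). -/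
def IsAffineTestFn (p K n : ℕ) (f : (Fin n → Bool) → Bool) : Prop :=
  ∃ (L : Fin K → Fin n → ZMod p) (b : Fin K → ZMod p) (F : (Fin K → ZMod p) → Bool),
    ∀ u : Fin n → Bool, f u = F (fun j => b j + ∑ i : Fin n, (if u i = true then L j i else 0))

/-- **Theorem A** (flag-less; statement verbatim Sketch19's `AffineTestsLoss`). -/
def AffineTestsLoss (p : ℕ) : Prop :=
  Odd p → ¬ 3 ∣ p → ∀ (K n c : ℕ) (y : Fin (n + 1) → (Fin n → Bool) → Bool),
    (∀ g : Fin (n + 1), IsAffineTestFn p K n (y g)) →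
      2 * p * Nat.clog 2 (2 * (n + 1) * p ^ K) ≤ n →
        2 ^ (n - 2 * p * Nat.clog 2 (2 * (n + 1) * p ^ K)) ≤ lossCount c y

/-- **Theorem A, kernel form.** -/
theorem affineTestsLoss (p : ℕ) : AffineTestsLoss p := by
  intro hp h3 K n c y hy hn
  classical
  haveI : NeZero p := ⟨by obtain ⟨k, hk⟩ := hp; omega⟩
  have hp0 : 0 < p := NeZero.pos p
  obtain ⟨F, instF, instC, η, ξ, hη, hξ⟩ := exists_charTwo_field_with_roots p hp
  have hη3 : η ^ 3 = 1 := hη.pow_eq_one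
  have hη1 : η ≠ 1 := hη.ne_one (by norm_num)
  let ψ : AddChar (ZMod p) F := AddChar.zmodChar p hξ.pow_eq_one
  have hψ : ∀ z : ZMod p, ψ z = ξ ^ z.val := fun z => AddChar.zmodChar_apply _ z
  have hψp : ∀ z : ZMod p, (ψ z) ^ p = 1 := by
    intro z
    rw [hψ, ← pow_mul, mul_comm, pow_mul, hξ.pow_eq_one, one_pow]
  choose L β f hf using hy
  -- the collapsed expansion: terms indexed by ι, all letters in the alphabet
  let ι := Fin (n + 1) × (Fin K → ZMod p) × Fin 2
  let ρ : ι → Fin n → F := fun t => formρ ψ η L t.1 t.2.1 t.2.2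
  have hρ : ∀ t ∈ (Finset.univ : Finset ι), ∀ i, ρ t i ∈ letterAlphabet p ψ η :=
    fun t _ i => formρ_mem_letterAlphabet ψ η hη3 L t.1 t.2.1 t.2.2 i
  -- the greedy posts on the first k coordinates
  set k := 2 * p * Nat.clog 2 (2 * (n + 1) * p ^ K) with hk
  obtain ⟨α, hαA, hsurv⟩ := greedy_posts (Finset.univ : Finset ι) ρ (letterAlphabet p ψ η)
    (letterAlphabet_nonempty ψ η) (2 * p) (letterAlphabet_card ψ η) hρ k hn
  -- numerics: (2p−1)^k · #T < (2p)^k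
  have hT : (Finset.univ : Finset ι).card = 2 * (n + 1) * p ^ K := by
    simp only [ι, Finset.card_univ, Fintype.card_prod, Fintype.card_fin, Fintype.card_fun, ZMod.card]
    ring
  have hL : 1 ≤ Nat.clog 2 (2 * (n + 1) * p ^ K) := by
    apply Nat.clog_pos (by norm_num)
    have : 1 ≤ p ^ K := Nat.one_le_pow _ _ hp0
    nlinarith
  have hnum : (2 * p - 1) ^ k * (Finset.univ : Finset ι).card < (2 * p) ^ k := by
    rw [hT, hk]
    set Lg := Nat.clog 2 (2 * (n + 1) * p ^ K) with hLg
    have hle : 2 * (n + 1) * p ^ K ≤ 2 ^ Lg := Nat.le_pow_clog (by norm_num) _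
    have hB : 2 * (2 * p - 1) ^ (2 * p) < (2 * p) ^ (2 * p) := two_mul_pow_lt_pow (2 * p) (by omega)
    calc (2 * p - 1) ^ (2 * p * Lg) * (2 * (n + 1) * p ^ K)
        ≤ (2 * p - 1) ^ (2 * p * Lg) * 2 ^ Lg := Nat.mul_le_mul_left _ hle
      _ = (2 * (2 * p - 1) ^ (2 * p)) ^ Lg := by rw [mul_pow, ← pow_mul, mul_comm]
      _ < ((2 * p) ^ (2 * p)) ^ Lg := Nat.pow_lt_pow_left hB (by omega)
      _ = (2 * p) ^ (2 * p * Lg) := by rw [← pow_mul]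
  -- hence no survivors: every term is hit by a post among the first k coordinates
  have hzero : (Finset.univ.filter fun t : ι => ∀ i : Fin n, i.val < k → ρ t i ≠ α i).card = 0 := by
    by_contra hne
    have h1 : 1 ≤ (Finset.univ.filter fun t : ι => ∀ i : Fin n, i.val < k → ρ t i ≠ α i).card :=
      Nat.one_le_iff_ne_zero.mpr hne
    have : (2 * p) ^ k ≤ (2 * p - 1) ^ k * (Finset.univ : Finset ι).card :=
      (le_mul_of_one_le_right (Nat.zero_le _) h1).trans hsurv
    omega
  have hhit : ∀ t ∈ (Finset.univ : Finset ι),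
      ∃ i ∈ (Finset.univ : Finset (Fin k)).map (Fin.castLEEmb hn), ρ t i = α i := by
    intro t _
    have ht : ¬ (∀ i : Fin n, i.val < k → ρ t i ≠ α i) := by
      intro hall
      have : t ∈ (Finset.univ.filter fun t : ι => ∀ i : Fin n, i.val < k → ρ t i ≠ α i) :=
        Finset.mem_filter.mpr ⟨Finset.mem_univ _, hall⟩
      rw [Finset.card_eq_zero.mp hzero] at this
      exact absurd this (Finset.notMem_empty _)
    push Not at ht
    obtain ⟨i, hi, hρi⟩ := ht
    refine ⟨i, Finset.mem_map.mpr ⟨⟨i.val, hi⟩, Finset.mem_univ _, Fin.ext rfl⟩, hρi⟩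
  have hP : ((Finset.univ : Finset (Fin k)).map (Fin.castLEEmb hn)).card = k := by simp
  have key := loss_ge_of_posts c y ι Finset.univ
    (fun t => ∑ r : Fin K → ZMod p, formC ψ η c f β t.1 r t.2.1 t.2.2) ρ
    ((Finset.univ : Finset (Fin k)).map (Fin.castLEEmb hn)) α
    (fun i _ => ne_one_of_mem_letterAlphabet ψ η hη h3 hψp _ (hαA i))
    hhit
    (form_expansion' ψ η hη3 hη1 hp hξ hψ c y L β f hf)
  rw [hP] at key
  exact key

/-- **(E-lin) of ROUND-17 §4**: no EXACT win for affine-test strategies once `k ≤ n` — kernel-checked. -/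
theorem no_exact_affine_win (p : ℕ) (hp : Odd p) (h3 : ¬ 3 ∣ p)
    (K n c : ℕ) (y : Fin (n + 1) → (Fin n → Bool) → Bool) (hy : ∀ g : Fin (n + 1), IsAffineTestFn p K n (y g))
    (hn : 2 * p * Nat.clog 2 (2 * (n + 1) * p ^ K) ≤ n) : ∃ u : Fin n → Bool, ringWinU c y u = false := by
  have h := affineTestsLoss p hp h3 K n c y hy hn
  have hpos : 0 < lossCount c y := lt_of_lt_of_le (pow_pos (by norm_num) _) h
  unfold lossCount at hpos
  obtain ⟨u, hu⟩ := Finset.card_pos.mp hpos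
  exact ⟨u, (Finset.mem_filter.mp hu).2⟩

end Summit.QuantumAdvantage.AdviceFreeQNC0.M19

end AffineA
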